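import Summits.BirchSwinnertonDyer.BirchSwinnertonDyer.Theorems.SignedLowerHalvesKobayashiMainConjectureSmallImageFineMuAnyReduction
import Summits.BirchSwinnertonDyer.BirchSwinnertonDyer.Theorems.SignedLowerHalvesKobayashiMainConjectureSmallImageMuSaturation
import Summits.BirchSwinnertonDyer.Rank1Residual.X10.CoreTheoremAOddPrimeHolds
import Literature.NumberTheory.EllipticCurves.Kobayashi2003.SignedColemanKatoZeta
import Literature.NumberTheory.EllipticCurves.Rank1Residual.PeriodUnitProofs
import Literature.NumberTheory.EllipticCurves.IwasawaAlgebraMuVanishingProofs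
import HarnessLib

/-!
# Route `SignedLowerHalves`, crux `KobayashiMainConjectureSmallImage` (item stmt-BirchSwinnertonDyer-19002):
# the EULER-SYSTEM `μ`-TRANSFER at NON-SURJECTIVE image, part 4 — ONE sign's unit coefficient bounds
# `μ(X^ε)` by `μ(L_p^ε)` for BOTH signs (the INTEGRAL `μ`-part of Kato's divisibility at small image),
# so `stub_saturationSmallImage` holds for every sign modulo the analytic rider for SOME sign
# (cell `bsd-ssimc`, WIDTH-LEVER lane B = seat `bsd-ssimc-k3-c4x` g0; helper file,
# `--supports stmt-BirchSwinnertonDyer-19002 --as helper`; theorems only; route-independent imports —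
# it does NOT import part 3, whose crux-by-name closer imports the route file)

HONEST FRAMING.  Kobayashi's signed main conjecture at a non-surjective image is OPEN and stays so;
nothing here is booked; BSD is not proved by any of this.  CONDITIONAL on the same displayed
binders as part 3 (`Theorems/…SmallImageSignedMuTransfer.lean`, p532179): the construction fact
`Kobayashi2003.thm62_63_73_signedColemanKato_zeta` (p529649), Kobayashi Thm. 1.2 / Thm. 4.1
RATIONAL / the period-unit pair, and the analytic rider — now for ONE sign `ε₀` only.

PARTITION (cell bsd-ssimc): X7 (A7) × item 4's ENTIRE domain — types-the-object-of; closes NONE.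

## The observation

In part 3 the rider `μ(L_p^ε(E)) = 0` was used for the SAME sign `ε` as the Selmer group.  But the
Euler-system input of the reduction-free core — a genuine class `z ∉ p𝐇¹_Γ(T_pW)` — does not
mention `ε`: Kato's zeta submodule `Z` is one object, only the Coleman map `Col^ε` depends on the
sign.  So a unit coefficient of `L_p^{ε₀}(E)` for ONE sign `ε₀` gives `μ(X₀(E/ℚ_∞)) = 0` once and for
all, and then Kobayashi's (7.21) for the OTHER sign `ε` bounds `length_(p) X^ε ≤ length_(p)
Λ/(Col^ε(Z)) = length_(p) Λ/(L_p^ε) = μ(L_p^ε)` — the `μ`-part of Kato's divisibility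
`char X^ε ⊇ (L_p^ε)`, INTEGRALLY, at non-surjective image, for BOTH signs.  With the Eisenstein half
for `ε` (`μ(char X^ε) ≥ μ(L_p^ε)`) this pins `μ` and saturates: `stub_saturationSmallImage` for
EVERY `ε` modulo the rider for SOME `ε₀`.

## Contents (theorems only)

* §0 `Λ`-algebra: `le_muInvariant_of_C_pow_dvd_of_charIdeal_eq_span` («`p^k ∣ g`, `char M = (g)`
  ⟹ `k ≤ μ(M)`», Greenberg–Vatsal p. 2 (2) / Washington §13.2, the `k > 0` half of the tree's
  `muInvariant_eq_zero_iff_not_C_dvd_of_charIdeal_eq_span`); `exists_eq_C_pow_mul_not_dvd` (content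
  factorisation `L = p^m·L′`, `p ∤ L′`).
* §1 `signed_lengthAt_le_of_hasUnitContent_anySign` — rider for `ε₀` ⟹ for every sign `ε` and its
  Pollack function `L`, `length_(p) X^ε(E/ℚ_∞) ≤ length_(p) Λ/(L)`.
* §2 `kobayashiMainConjecture_of_lengthAt_le_of_lowerDivisibility` — the Eisenstein half for `ε` +
  that inequality ⟹ `KobayashiMainConjecture W p ε`; `stub_saturationSmallImage_of_signedMuAn_oneSign`
  — the REGISTERED stub for every sign modulo the facts and the rider for SOME sign (per pair).

References: [Kobayashi2003] Thm. 6.2, 6.3, 7.3 (7.21), Thm. 1.2, Thm. 4.1; [Kato2004Asterisque]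
Thm. 12.6, §13.8; [GreenbergVatsal2000] p. 2 (1)–(2), §3; [Washington1997] §13.2; tree: parts 1–3
(this seat: p528404, p529649, p532179), lane A's `…SmallImageMuSaturation` (p447454).
-/

set_option linter.dupNamespace false
set_option autoImplicit false

noncomputable section

open scoped Classical MatrixGroups ModularForm Polynomial

open CongruenceSubgroup WeierstrassCurve Field
  Literature.NumberTheory.EllipticCurves Literature.NumberTheory.EllipticCurves.ModularForms
  Literature.NumberTheory.EllipticCurves.Rank1Residual
  Literature.NumberTheory.EllipticCurves.Kobayashi2003 Literature.NumberTheory.EllipticCurves.Kato2004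
  Literature.NumberTheory.EllipticCurves.GreenbergVatsal2000 ZpExtension
  Literature.NumberTheory.EllipticCurves.IwasawaAlgebra Literature.NumberTheory.EllipticCurves.Module
  Summit.BirchSwinnertonDyer.Rank1Residual.Supersingular
  Summit.BirchSwinnertonDyer.BirchSwinnertonDyer.Rank1Residual

namespace Summit.BirchSwinnertonDyer.BirchSwinnertonDyer.Theorems.SmallImageSignedMuTransfer

/-! ### §0 `Λ`-algebra: `p^k ∣ (char M) ⟹ k ≤ μ(M)`; content factorisation -/

section Algebra

variable {p : ℕ} [Fact p.Prime]

/-- **`p^k ∣ g ⟹ k ≤ μ(M)` for a generator `g` of the characteristic ideal** of a finitely generated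
torsion `Λ`-module `M` — the general-`k` half of Greenberg–Vatsal's "`p^{μ}` is the exact power of
`p` dividing the characteristic power series" (the tree's `muInvariant_eq_zero_iff_not_C_dvd_of_charIdeal_eq_span`
is the case `k = 1`).  Structure theorem (`exists_isPseudoIsomorphism_elementary_holds`): `M ∼ E(μs, fs)`,
`char M = (p^{∑μ}·∏ f_j^{n_j})` (`charIdeal_eq_span_holds`), `μ(M) = ∑μ` (`muInvariant_eq_sum_holds`),
`p ∤ ∏ f_j^{n_j}` (distinguished), `g` associated to that element; then `p^k ∣ p^{∑μ}·(unit·∏)`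
forces `p^k ∣ p^{∑μ}`. [cite: GreenbergVatsal2000, p. 2, (1)–(2)] [cite: Washington1997, §13.2] -/
theorem le_muInvariant_of_C_pow_dvd_of_charIdeal_eq_span
    (M : Type*) [AddCommGroup M] [Module (IwasawaAlgebra p) M]
    [Module.Finite (IwasawaAlgebra p) M] (hM : Module.IsTorsion (IwasawaAlgebra p) M)
    {g : IwasawaAlgebra p} (hg : charIdeal (IwasawaAlgebra p) M = Ideal.span {g})
    {k : ℕ} (hk : PowerSeries.C (p : ℤ_[p]) ^ k ∣ g) : k ≤ muInvariant p M := by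
  obtain ⟨μs, fs, -, hfs, hψ⟩ := exists_isPseudoIsomorphism_elementary_holds p M hM
  have hfs' : ∀ f ∈ fs, f.1.IsDistinguishedAt (IsLocalRing.maximalIdeal ℤ_[p]) :=
    fun f hf => (hfs f hf).1
  have hchar : charIdeal (IwasawaAlgebra p) M = Ideal.span {charElement p μs fs} :=
    charIdeal_eq_span_holds p M hfs' hψ
  have hμ : muInvariant p M = μs.sum := muInvariant_eq_sum_holds p M hfs' hψ
  obtain ⟨u, hu⟩ := Ideal.span_singleton_eq_span_singleton.mp (hg.symm.trans hchar)
  -- `p` divides no factor of the distinguished product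
  set P : IwasawaAlgebra p := (fs.map fun f => (f.1 : IwasawaAlgebra p) ^ f.2).prod with hP
  have hPnd : ¬ PowerSeries.C (p : ℤ_[p]) ∣ P := by
    intro hP'
    obtain ⟨x, hx, hpx⟩ := (prime_C p).exists_mem_multiset_dvd
      (by rwa [hP, ← Multiset.prod_coe, ← Multiset.map_coe] at hP')
    rw [Multiset.map_coe, Multiset.mem_coe, List.mem_map] at hx
    obtain ⟨f, hf, rfl⟩ := hx
    exact coe_notMem_augIdealP_of_isDistinguishedAt p (hfs' f hf)
      (by rw [augIdealP, Ideal.mem_span_singleton]; exact (prime_C p).dvd_of_dvd_pow hpx)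
  -- `p^k ∣ g·u = p^{∑μ} · P` (the generator `g` is associated to the characteristic element)
  have hk' : PowerSeries.C (p : ℤ_[p]) ^ k ∣ PowerSeries.C (p : ℤ_[p]) ^ μs.sum * P := by
    have h1 : PowerSeries.C (p : ℤ_[p]) ^ k ∣ g * (u : IwasawaAlgebra p) := hk.mul_right _
    rw [hu, charElement, map_pow] at h1
    simpa [hP] using h1
  have hkk := (prime_C p).pow_dvd_of_dvd_mul_right k hPnd hk'
  rw [hμ]
  exact (pow_dvd_pow_iff (prime_C p).ne_zero (prime_C p).not_unit).mp hkk

/-- Content factorisation in `Λ`: a non-zero `L` is `p^m · L′` with `p ∤ L′` (`Λ` is Noetherian,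
hence a `WfDvdMonoid`). [folklore] [cite: Washington1997, §7.1] -/
theorem exists_eq_C_pow_mul_not_dvd {L : IwasawaAlgebra p} (hL : L ≠ 0) :
    ∃ (m : ℕ) (L' : IwasawaAlgebra p), ¬ PowerSeries.C (p : ℤ_[p]) ∣ L' ∧
      L = PowerSeries.C (p : ℤ_[p]) ^ m * L' :=
  WfDvdMonoid.max_power_factor' hL (prime_C p).not_unit

/-- At `𝔭 = (p)`, `length_(p) Λ/(L) = m` for `L = p^m · L′`, `p ∤ L′`. [folklore] [cite: Washington1997, §13.2] -/
theorem lengthAt_quotient_span_eq_of_eq_C_pow_mul {L L' : IwasawaAlgebra p} {m : ℕ}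
    (hL' : ¬ PowerSeries.C (p : ℤ_[p]) ∣ L') (hL : L = PowerSeries.C (p : ℤ_[p]) ^ m * L')
    (𝔭 : PrimeSpectrum (IwasawaAlgebra p)) (h𝔭 : 𝔭.asIdeal = augIdealP p) :
    lengthAt (IwasawaAlgebra p) (IwasawaAlgebra p ⧸ Ideal.span {L}) 𝔭 = m := by
  rw [hL]
  exact lengthAt_quotient_span_singleton_pow_mul (prime_C p) m hL' 𝔭 (by rw [h𝔭, augIdealP])

end Algebra

/-! ### §1 ONE sign's unit coefficient ⟹ `length_(p) X^ε ≤ length_(p) Λ/(L_p^ε)` for EVERY sign -/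

section OneSign

variable (W : WeierstrassCurve ℚ) [W.IsElliptic] [W.IsGloballyMinimal] (p : ℕ) [Fact p.Prime]

/-- **The INTEGRAL `μ`-part of Kato's divisibility for BOTH signed Selmer groups from ONE unit
coefficient.**  Let `W/ℚ` be globally minimal, `p` an odd good prime with `a_p = 0` and `ρ̄_{E,p}`
NOT onto, `f` a newform with period ratio `ϖ`, and suppose the sign-`ε₀` Pollack function `L₀` has a
`p`-adic unit coefficient for SOME sign `ε₀`.  Then for EVERY sign `ε`, its Pollack function `L` and
every dual datum `D` of `Sel^ε(E/ℚ_∞)`: `length_(p) X^ε ≤ length_(p) Λ/(L)`, i.e. `μ(X^ε) ≤ μ(L_p^ε)`.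
Proof: the `ε₀`-package and the rider give a genuine Euler-system class `∉ p𝐇¹` (independent of the
sign), the reduction-free core gives `length_(p) X₀ = 0` (part 1); the `ε`-package's (7.21) through
`Col^ε` gives `length_(p) X^ε ≤ length_(p) Λ/M + length_(p) X₀` with `M = Col^ε(Z) ∋ s·G₁`, `s ∉ (p)`,
`(G₁) = (L)`, so `length_(p) Λ/M ≤ length_(p) Λ/(s·G₁) = length_(p) Λ/(L)`.  CONDITIONAL on the
displayed binders; NO partner, NO congruence, NO preprint.
[cite: Kobayashi2003, Thm. 6.2 (6.13)–(6.14), Thm. 6.3 (p. 11) and Thm. 7.3 i) (7.21) (p. 13)]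
[cite: Kato2004Asterisque, Thm. 12.6 (p. 222), §13.8 (pp. 228–229) and §17.13 (p. 280)] -/
theorem signed_lengthAt_le_of_hasUnitContent_anySign (hCK : thm62_63_73_signedColemanKato_zeta)
    (h5 : realPeriodRat_eq_unit_mul_plusPeriod) (h3 : realPeriodRat_eq_unit_mul_plusPeriod_three)
    (hp : p ≠ 2) (hgood : W.HasGoodReductionAtPrime p) (hap : W.frobeniusTrace p = 0)
    (hns : ¬ W.HasSurjectiveModNGaloisRep p)
    {N : ℕ} [NeZero N] (f : CuspForm (Gamma0 N) 2) (hf : IsNewformOf W f)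
    (ϖ : ℚ) (hϖ : (ϖ : ℝ) * W.realPeriodRat = plusPeriod f)
    {ε₀ : ℤˣ} {L₀ : IwasawaAlgebra p} (hL₀ : IsSignedPAdicLFunction f p ε₀ L₀)
    (hu₀ : HasUnitContent L₀)
    {ε : ℤˣ} {L : IwasawaAlgebra p} (hL : IsSignedPAdicLFunction f p ε L)
    (κ : ZpExtension ℚ p) (γ : absoluteGaloisGroup ℚ) (hκ : κ.IsCyclotomic) (hγ : κ.IsTopGenerator γ)
    (hγ' : IsCyclotomicVariable p γ) (D : SignedSelmerDualData W κ γ ε)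
    (𝔭 : PrimeSpectrum (IwasawaAlgebra p)) (h𝔭 : 𝔭.asIdeal = augIdealP p) :
    lengthAt (IwasawaAlgebra p) D.X 𝔭 ≤
      lengthAt (IwasawaAlgebra p) (IwasawaAlgebra p ⧸ Ideal.span {L}) 𝔭 := by
  haveI : ContinuousSMul ℤ_[p] (W.tateModule p) := TateModule.continuousSMul_padicInt
  haveI : Module.Free ℤ_[p] (W.tateModule p) := W.module_free_tateModule_holds p
  haveI : Module.Finite ℤ_[p] (W.tateModule p) := W.module_finite_tateModule_holds p
  have hirr : W.HasIrreducibleModPGaloisRep p :=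
    hasIrreducibleModPGaloisRep_of_dvd_frobeniusTrace W p hp
      (W.not_dvd_minimalDiscriminantInt_of_hasGoodReductionAtPrime' p hgood) (by rw [hap]; exact dvd_zero _)
  obtain ⟨I⟩ := nonempty_iwasawaH1Data_holds W p κ γ hκ hγ
  obtain ⟨Y⟩ := W.nonempty_fineSelmerDualData κ hγ
  obtain ⟨K₀⟩ := hCK W p f ϖ κ γ hp hgood hap hf hϖ hκ hγ hγ' ε₀ I
  obtain ⟨K⟩ := hCK W p f ϖ κ γ hp hgood hap hf hϖ hκ hγ hγ' ε I
  obtain ⟨j, k, hcj, hjk, -⟩ := K.exact D Y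
  -- the period unit and the Néron-normalised functions `G₀ = C(u) L₀`, `G₁ = C(u) L`
  have hvϖ : padicValRat p ϖ = 0 :=
    Rank1Residual.padicValRat_periodRatio_eq_zero h5 h3 W p hp hgood hirr f hf ϖ hϖ
  have hϖ0 : ϖ ≠ 0 := by
    intro hz
    rw [hz, Rat.cast_zero, zero_mul] at hϖ
    exact (IsNewform0.plusPeriod_pos_holds hf.1 hf.coeffField_eq_bot).ne' hϖ.symm
  obtain ⟨u, hu'⟩ := exists_units_coe_eq_ratCast hϖ0 hvϖ
  obtain ⟨-, hι₀⟩ := span_C_units_mul_eq u L₀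
  obtain ⟨hspan₁, hι₁⟩ := span_C_units_mul_eq u L
  set G₀ : IwasawaAlgebra p := PowerSeries.C (u : ℤ_[p]) * L₀ with hG₀def
  set G₁ : IwasawaAlgebra p := PowerSeries.C (u : ℤ_[p]) * L with hG₁def
  have hG₀ : iwasawaToPowerSeries p G₀ =
      PowerSeries.C ((ϖ : ℚ) : ℚ_[p]) * iwasawaToPowerSeries p L₀ := by rw [hι₀, hu']
  have hG₁ : iwasawaToPowerSeries p G₁ =
      PowerSeries.C ((ϖ : ℚ) : ℚ_[p]) * iwasawaToPowerSeries p L := by rw [hι₁, hu']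
  have hL₀p : L₀ ∉ augIdealP p := KatoMuSkeleton.not_mem_augIdealP_of_hasUnitContent hu₀
  have hG₀p : G₀ ∉ augIdealP p := by
    intro h
    apply hL₀p
    have h' := Ideal.mul_mem_left (augIdealP p) (PowerSeries.C ((u⁻¹ : ℤ_[p]ˣ) : ℤ_[p])) h
    rwa [hG₀def, ← mul_assoc, ← map_mul, Units.inv_mul, map_one, one_mul] at h'
  have h𝔭1 : 𝔭.asIdeal.height = 1 := by rw [h𝔭]; exact height_augIdealP_holds p
  -- sign `ε₀`: a genuine Euler-system class outside `p𝐇¹`, and `length_(p) X₀ = 0`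
  obtain ⟨s₀, hs₀, hs₀G, -⟩ := K₀.image_zeta_localized hirr L₀ G₀ hL₀ hG₀ 𝔭 h𝔭1
  have hs₀' : s₀ ∉ augIdealP p := h𝔭 ▸ hs₀
  obtain ⟨z, hzES, hzp⟩ := exists_mem_set_not_mem_pSmul K₀.col K₀.Z K₀.zeta_le_span hs₀' hG₀p hs₀G
  obtain ⟨_, hY0⟩ := fineSelmerDual_lengthAt_augIdealP_eq_zero_of_eulerSystemClass W p κ γ I hp hirr
    hns hκ hγ ⟨z, hzES, hzp⟩ Y 𝔭 h𝔭
  -- sign `ε`: (7.21) through `Col^ε`, `M := Col^ε(Z) ∋ s·G₁` with `s ∉ (p)`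
  obtain ⟨s, hs, hsG, -⟩ := K.image_zeta_localized hirr L G₁ hL hG₁ 𝔭 h𝔭1
  set M : Ideal (IwasawaAlgebra p) := Submodule.map K.col K.Z with hM
  have hle : M ≤ LinearMap.ker j := by
    rintro _ ⟨x, -, rfl⟩
    exact (hcj (K.col x)).mpr ⟨x, rfl⟩
  let j' : (IwasawaAlgebra p ⧸ M) →ₗ[IwasawaAlgebra p] D.X := M.liftQ j hle
  have hj' : Function.Exact j' k := by
    rw [LinearMap.exact_iff, Submodule.range_liftQ]
    exact LinearMap.exact_iff.mp hjk
  -- `length Λ/M ≤ length Λ/(s·G₁) = length Λ/(s) + length Λ/(G₁) = 0 + length Λ/(L)`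
  have hsne : s ≠ 0 := fun h0 ↦ hs (h0 ▸ 𝔭.asIdeal.zero_mem)
  have hsub : Ideal.span {s * G₁} ≤ M := by
    rw [Ideal.span_singleton_le_iff_mem]; exact hsG
  have hsurj : Function.Surjective (Submodule.factor hsub) := Submodule.factor_surjective hsub
  have hM_le : lengthAt (IwasawaAlgebra p) (IwasawaAlgebra p ⧸ M) 𝔭 ≤
      lengthAt (IwasawaAlgebra p) (IwasawaAlgebra p ⧸ Ideal.span {L}) 𝔭 := by
    calc lengthAt (IwasawaAlgebra p) (IwasawaAlgebra p ⧸ M) 𝔭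
        ≤ lengthAt (IwasawaAlgebra p) (IwasawaAlgebra p ⧸ Ideal.span {s * G₁}) 𝔭 :=
          lengthAt_le_of_surjective _ hsurj 𝔭
      _ = lengthAt (IwasawaAlgebra p) (IwasawaAlgebra p ⧸ Ideal.span {s}) 𝔭 +
            lengthAt (IwasawaAlgebra p) (IwasawaAlgebra p ⧸ Ideal.span {G₁}) 𝔭 :=
          lengthAt_quotient_span_singleton_mul G₁ hsne 𝔭
      _ = lengthAt (IwasawaAlgebra p) (IwasawaAlgebra p ⧸ Ideal.span {L}) 𝔭 := by
          rw [lengthAt_quotient_eq_zero_of_not_le (I := Ideal.span {s})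
            (by rwa [Ideal.span_singleton_le_iff_mem]), zero_add, hG₁def, hspan₁]
  calc lengthAt (IwasawaAlgebra p) D.X 𝔭
      ≤ lengthAt (IwasawaAlgebra p) (IwasawaAlgebra p ⧸ M) 𝔭 + lengthAt (IwasawaAlgebra p) Y.X 𝔭 :=
        lengthAt_le_add_of_exact j' k hj' 𝔭
    _ ≤ lengthAt (IwasawaAlgebra p) (IwasawaAlgebra p ⧸ Ideal.span {L}) 𝔭 := by
        rw [hY0, add_zero]; exact hM_le

end OneSign

/-! ### §2 Saturation for every sign from the rider for SOME sign -/

section Saturation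

variable (W : WeierstrassCurve ℚ) [W.IsElliptic] [W.IsGloballyMinimal] (p : ℕ) [Fact p.Prime]

/-- **`lower ⇒ equality` from the `μ`-INEQUALITY `μ(X^ε) ≤ μ(L_p^ε)`.**  Let `p` be an odd good prime
of `E = W` with `a_p = 0`, and suppose that in the conjecture's own setting (cyclotomic `(κ, γ)`, the
newform `f` of conductor level, period ratio `ϖ`) every dual datum `D` of `Sel^ε(E/ℚ_∞)` satisfies
`length_(p) X^ε ≤ length_(p) Λ/(L)` for the sign-`ε` Pollack function `L` of `f` (`hμle`, displayed —
§1 supplies it from ONE sign's unit coefficient at non-surjective image).  Granted BY NAME Kobayashi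
Thm. 1.2 (`h12`), Thm. 4.1 RATIONAL (`h41`) and the period-unit pair: the Eisenstein half
`KobayashiLowerDivisibility W p ε` implies `KobayashiMainConjecture W p ε`.  Proof: lower gives
`char X^ε = (g)`, `g = C(u)·L·h`; Thm. 4.1 rational gives `g ∣ pⁿ·L`, so `h ∣ pⁿ` and `h ~ p^m`;
write `L = p^{m_L}·L′`, `p ∤ L′`; then `p^{m+m_L} ∣ g` so `m + m_L ≤ μ(X^ε)` (§0), while `μ(X^ε) =
length_(p) X^ε ≤ length_(p) Λ/(L) = m_L`; hence `m = 0`, `h ∈ Λˣ`.  CONDITIONAL; ANY rank; NO partner;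
NO `BSD(E,p)` input.
[cite: Kobayashi2003, Thm. 1.2 (p. 2), Thm. 4.1 (p. 8) and p. 2 (the main [C])]
[cite: GreenbergVatsal2000, p. 2 (1)–(2) and §3 Remark 3.4] [cite: Washington1997, §13.2] -/
theorem kobayashiMainConjecture_of_lengthAt_le_of_lowerDivisibility
    (h12 : Kobayashi2003.thm12_signedSelmerDual_finite_torsion)
    (h41 : Kobayashi2003.thm41_signedCharIdeal_divisibility)
    (h5 : realPeriodRat_eq_unit_mul_plusPeriod) (h3 : realPeriodRat_eq_unit_mul_plusPeriod_three)
    (hp : p ≠ 2) (hgood : W.HasGoodReductionAtPrime p) (hap : W.frobeniusTrace p = 0) {ε : ℤˣ}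
    (hμle : ∀ (κ : ZpExtension ℚ p) (γ : absoluteGaloisGroup ℚ),
      κ.IsCyclotomic → κ.IsTopGenerator γ → IsCyclotomicVariable p γ →
      ∀ [NeZero (W.conductorNorm ℤ)] (f : CuspForm (Gamma0 (W.conductorNorm ℤ)) 2),
      IsNewformOf W f → ∀ (ϖ : ℚ), (ϖ : ℝ) * W.realPeriodRat = plusPeriod f →
      ∀ (L : IwasawaAlgebra p), IsSignedPAdicLFunction f p ε L →
      ∀ (D : SignedSelmerDualData W κ γ ε) (𝔭 : PrimeSpectrum (IwasawaAlgebra p)),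
        𝔭.asIdeal = augIdealP p →
        lengthAt (IwasawaAlgebra p) D.X 𝔭 ≤
          lengthAt (IwasawaAlgebra p) (IwasawaAlgebra p ⧸ Ideal.span {L}) 𝔭)
    (hlow : KobayashiLowerDivisibility W p ε) : KobayashiMainConjecture W p ε := by
  intro κ γ hκ hγ hγ' _ f hf ϖ hϖ Lplus Lminus hPP D
  haveI hfin : Module.Finite (IwasawaAlgebra p) D.X := h12.moduleFinite hp hgood hap hκ hγ D
  have hX : Module.IsTorsion (IwasawaAlgebra p) D.X := h12.isTorsion hp hgood hap hκ hγ D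
  refine ⟨hX, ?_⟩
  set L := kobayashiL ε Lplus Lminus with hL_def
  have hL : IsSignedPAdicLFunction f p ε L := hPP.isSignedPAdicLFunction_kobayashiL ε
  have hLne : L ≠ 0 := by
    rw [hL_def, kobayashiL]
    split_ifs
    · exact hPP.2.1
    · exact hPP.1
  -- the Eisenstein half: `char X^ε = (g)`, `ι g = ϖ · ι (L · h)`, `g = C(u) · (L · h)`
  obtain ⟨g, h, hchar, hιg⟩ := hlow κ γ hκ hγ hγ' f hf ϖ hϖ Lplus Lminus hPP D
  have hirr : W.HasIrreducibleModPGaloisRep p :=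
    hasIrreducibleModPGaloisRep_of_dvd_frobeniusTrace W p hp
      (W.not_dvd_minimalDiscriminantInt_of_hasGoodReductionAtPrime' p hgood) (by rw [hap]; exact dvd_zero _)
  have hvϖ : padicValRat p ϖ = 0 :=
    Rank1Residual.padicValRat_periodRatio_eq_zero h5 h3 W p hp hgood hirr f hf ϖ hϖ
  have hϖ0 : ϖ ≠ 0 := by
    intro hz
    rw [hz, Rat.cast_zero, zero_mul] at hϖ
    exact (IsNewform0.plusPeriod_pos_holds hf.1 hf.coeffField_eq_bot).ne' hϖ.symm
  obtain ⟨u, hu'⟩ := exists_units_coe_eq_ratCast hϖ0 hvϖ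
  obtain ⟨-, hιu⟩ := span_C_units_mul_eq u (L * h)
  have hgeq : g = PowerSeries.C (u : ℤ_[p]) * (L * h) :=
    iwasawaToPowerSeries_injective p (by rw [hιg, hιu, hu'])
  -- Thm. 4.1 rational: `g ∣ pⁿ · L`, so `h ∣ C(p)ⁿ`, `h ~ C(p)^m`
  obtain ⟨n, hn⟩ := h41.exists_dvd_pow_mul hp hgood hap hf hκ hγ hγ' hL D hX hchar
  have hCp : ((p : IwasawaAlgebra p) ^ n : IwasawaAlgebra p) = PowerSeries.C (p : ℤ_[p]) ^ n := by
    rw [map_natCast]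
  rw [hCp] at hn
  have hhd : h ∣ PowerSeries.C (p : ℤ_[p]) ^ n := by
    -- `L · (C(u)·h) ∣ L · C(p)^n` ⟹ `C(u)·h ∣ C(p)^n` ⟹ `h ∣ C(p)^n`
    have h1 : L * (PowerSeries.C (u : ℤ_[p]) * h) ∣ L * PowerSeries.C (p : ℤ_[p]) ^ n := by
      have : g = L * (PowerSeries.C (u : ℤ_[p]) * h) := by rw [hgeq]; ring
      rw [← this, mul_comm L]; exact hn
    have h2 : PowerSeries.C (u : ℤ_[p]) * h ∣ PowerSeries.C (p : ℤ_[p]) ^ n :=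
      (mul_dvd_mul_iff_left hLne).mp h1
    exact dvd_trans (Dvd.intro_left _ rfl) h2
  obtain ⟨m, -, hm⟩ := (dvd_prime_pow (prime_C p) n).mp hhd
  -- content of `L`: `L = C(p)^{mL} · L'`, `p ∤ L'`
  obtain ⟨mL, L', hL', hLfac⟩ := exists_eq_C_pow_mul_not_dvd hLne
  -- `C(p)^{m + mL} ∣ g`, hence `m + mL ≤ μ(X^ε)`
  obtain ⟨v, hv⟩ := hm
  -- `hv : h * v = C(p)^m` with `v` a unit
  have hheq : h = PowerSeries.C (p : ℤ_[p]) ^ m * ((v⁻¹ : (IwasawaAlgebra p)ˣ) : IwasawaAlgebra p) := by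
    rw [← hv, mul_assoc, Units.mul_inv, mul_one]
  have hdvdg : PowerSeries.C (p : ℤ_[p]) ^ (m + mL) ∣ g := by
    refine ⟨PowerSeries.C (u : ℤ_[p]) * L' * ((v⁻¹ : (IwasawaAlgebra p)ˣ) : IwasawaAlgebra p), ?_⟩
    rw [hgeq, hLfac, hheq, pow_add]
    ring
  have hle1 : m + mL ≤ muInvariant p D.X :=
    le_muInvariant_of_C_pow_dvd_of_charIdeal_eq_span D.X hX hchar hdvdg
  -- `μ(X^ε) ≤ mL` from the displayed inequality
  let 𝔭 : PrimeSpectrum (IwasawaAlgebra p) := ⟨augIdealP p, isPrime_augIdealP_holds p⟩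
  have hlen := hμle κ γ hκ hγ hγ' f hf ϖ hϖ L hL D 𝔭 rfl
  rw [lengthAt_quotient_span_eq_of_eq_C_pow_mul hL' hLfac 𝔭 rfl] at hlen
  have hle2 : muInvariant p D.X ≤ mL := by
    rw [muInvariant_eq_toNat_lengthAt p D.X 𝔭 rfl]
    have hne : lengthAt (IwasawaAlgebra p) D.X 𝔭 ≠ ⊤ := lengthAt_ne_top_of_isTorsion p D.X hX 𝔭 rfl
    have : ((lengthAt (IwasawaAlgebra p) D.X 𝔭).toNat : ℕ∞) ≤ (mL : ℕ∞) := by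
      rw [ENat.coe_toNat hne]; exact hlen
    exact_mod_cast this
  have hm0 : m = 0 := by omega
  -- so `h` is a unit and `char X^ε = (C(u) · L)`
  have hunit : IsUnit h := by
    rw [hheq, hm0, pow_zero, one_mul]; exact Units.isUnit _
  obtain ⟨-, hι⟩ := span_C_units_mul_eq u L
  refine ⟨PowerSeries.C (u : ℤ_[p]) * L, ?_, ?_⟩
  · rw [hchar, hgeq, ← mul_assoc]
    exact Ideal.span_singleton_mul_right_unit hunit _
  · rw [hι, hu']

/-- **Saturation for EVERY sign from the rider for SOME sign, no partner** (§1 ∘ the previous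
theorem): odd good `p`, `a_p = 0`, `ρ̄_{E,p}` NOT onto; for the newform `f` of `W` (conductor level)
SOME sign `ε₀` whose Pollack function has a unit coefficient (`hμan₀`, displayed) ⟹ for EVERY sign
`ε`, the Eisenstein half implies the main [C].  Binders: `hCK`, `h12`, `h41` (rational), `h5`, `h3` by
name.  [cite: Kobayashi2003, Thm. 6.3 (p. 11), Thm. 7.3 (p. 13), Thm. 4.1 (p. 8)] [cite: Kato2004Asterisque, Thm. 12.6 (p. 222), §13.8 (pp. 228–229)] -/
theorem kobayashiMainConjecture_of_signedMuAn_oneSign_of_lowerDivisibility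
    (hCK : thm62_63_73_signedColemanKato_zeta)
    (h12 : Kobayashi2003.thm12_signedSelmerDual_finite_torsion)
    (h41 : Kobayashi2003.thm41_signedCharIdeal_divisibility)
    (h5 : realPeriodRat_eq_unit_mul_plusPeriod) (h3 : realPeriodRat_eq_unit_mul_plusPeriod_three)
    (hp : p ≠ 2) (hgood : W.HasGoodReductionAtPrime p) (hap : W.frobeniusTrace p = 0)
    (hns : ¬ W.HasSurjectiveModNGaloisRep p)
    (hμan₀ : ∀ [NeZero (W.conductorNorm ℤ)] (f : CuspForm (Gamma0 (W.conductorNorm ℤ)) 2),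
      IsNewformOf W f → ∃ (ε₀ : ℤˣ) (L₀ : IwasawaAlgebra p),
        IsSignedPAdicLFunction f p ε₀ L₀ ∧ HasUnitContent L₀)
    (ε : ℤˣ) (hlow : KobayashiLowerDivisibility W p ε) : KobayashiMainConjecture W p ε := by
  refine kobayashiMainConjecture_of_lengthAt_le_of_lowerDivisibility W p h12 h41 h5 h3 hp hgood hap
    ?_ hlow
  intro κ γ hκ hγ hγ' _ f hf ϖ hϖ L hL D 𝔭 h𝔭
  obtain ⟨ε₀, L₀, hL₀, hu₀⟩ := hμan₀ f hf
  exact signed_lengthAt_le_of_hasUnitContent_anySign W p hCK h5 h3 hp hgood hap hns f hf ϖ hϖ hL₀ hu₀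
    hL κ γ hκ hγ hγ' D 𝔭 h𝔭

end Saturation

/-- **The REGISTERED stub `stub_saturationSmallImage` for EVERY sign modulo the analytic rider for
SOME sign** (skeleton `Lines/birth.lean`, sha16 b1bf5b11c746572b; conclusion verbatim): binders = the
construction fact `hCK`, the published `h12`, `h41` (rational), `h5`, `h3`, and the class-wide ONE-SIGN
rider `hμan₀` («on item 4's domain, for the newform of conductor level, ONE of the two signed Pollack
functions has a unit coefficient» — half of part 3's rider; per pair a finite certificate).  NO
partner, NO congruence, NO preprint; nothing booked; crux 4 stays OPEN (Eisenstein half engine-less).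
[cite: Kobayashi2003, Thm. 1.2 (p. 2), Thm. 4.1 (p. 8), Thm. 6.2–6.3 (p. 11), Thm. 7.3 (p. 13)]
[cite: Kato2004Asterisque, Thm. 12.6 (p. 222), §13.8 (pp. 228–229)] -/
theorem stub_saturationSmallImage_of_signedMuAn_oneSign (hCK : thm62_63_73_signedColemanKato_zeta)
    (h12 : Kobayashi2003.thm12_signedSelmerDual_finite_torsion)
    (h41 : Kobayashi2003.thm41_signedCharIdeal_divisibility)
    (h5 : realPeriodRat_eq_unit_mul_plusPeriod) (h3 : realPeriodRat_eq_unit_mul_plusPeriod_three)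
    (hμan₀ : ∀ (W : WeierstrassCurve ℚ) [W.IsElliptic] [W.IsGloballyMinimal] (p : ℕ) [Fact p.Prime],
      p ≠ 2 → ClassX7 W p → ¬ W.HasCM → W.frobeniusTrace p = 0 → ¬ Surj W p →
      ∀ [NeZero (W.conductorNorm ℤ)] (f : CuspForm (Gamma0 (W.conductorNorm ℤ)) 2),
      IsNewformOf W f → ∃ (ε₀ : ℤˣ) (L₀ : IwasawaAlgebra p),
        IsSignedPAdicLFunction f p ε₀ L₀ ∧ HasUnitContent L₀) :
    ∀ (W : WeierstrassCurve ℚ) [W.IsElliptic] [W.IsGloballyMinimal] (p : ℕ) [Fact p.Prime],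
      p ≠ 2 → ClassX7 W p → ¬ W.HasCM → W.frobeniusTrace p = 0 → ¬ Surj W p →
      ∀ ε : ℤˣ, Summit.BirchSwinnertonDyer.Rank1Residual.Supersingular.KobayashiLowerDivisibility W p ε →
        Summit.BirchSwinnertonDyer.Rank1Residual.Supersingular.KobayashiMainConjecture W p ε := by
  intro W _ _ p _ hp hX hcm hap hs ε hlow
  exact kobayashiMainConjecture_of_signedMuAn_oneSign_of_lowerDivisibility W p hCK h12 h41 h5 h3 hp
    hX.1.1 hap hs (fun f hf ↦ hμan₀ W p hp hX hcm hap hs f hf) ε hlow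

end Summit.BirchSwinnertonDyer.BirchSwinnertonDyer.Theorems.SmallImageSignedMuTransfer

end
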